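import Mathlib

/-!
# (★) on the star gadget with `n` copies of the PURE PAIR `P[xc|xc]`: the exponential-polynomial inequality `G ≥ 0`

`G p q r s n` is the (★)-slack (`#Kc + #Lc + #KLc₂ − #KL` over bot) of the gadget: marks `a b c`, the centre `x ~ c`, `p, q, r, s` hubs
of the types `{a,b}, {a,c}, {b,c}, {a,b,c}`, and `n` copies of the two-vertex branch `u ~ v`, `u, v ~ x`, `u, v ~ c` (two PURE vertices
each) — the closed form given by the 4-terminal profile theorem (dossier §27.4, §27.9; row M3-ONETYPE).  The proof is the exact
certificate tree of record (data/mine-3/g20/single-p2.json): half-space domination certificates, finite boxes, case splits on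
`x = 0 / x ≥ 1`.  A factor `(0:ℤ)^x` is the indicator `[x = 0]`.
-/

namespace PercRepro.StarGadget

/-- the (★)-slack of the gadget x ~ c + hubs (p, q, r, s) + n pure pairs P[xc|xc] (29 terms) -/
def G (p q r s n : ℕ) : ℤ :=
    2 * ((4:ℤ)^p * 5^q * 5^r * 6^s * 32^n) - 2 * ((3:ℤ)^p * 2^q * 5^r * 3^s * 32^n) - 2 * ((3:ℤ)^p * 5^q * 2^r * 3^s * 32^n) + 2 * ((2:ℤ)^p * 5^q * 2^r * 2^s * 32^n) + 2 * ((2:ℤ)^p * 2^q * 5^r * 2^s * 32^n) - 2 * ((2:ℤ)^q * 2^r * 32^n) + (5:ℤ)^p * 5^q * 4^r * 6^s * 16^n + (5:ℤ)^p * 4^q * 5^r * 6^s * 16^n - (5:ℤ)^p * 5^q * 3^r * 5^s * 16^n - (5:ℤ)^p * 3^q * 5^r * 5^s * 16^n - 2 * ((4:ℤ)^p * 4^q * 4^r * 5^s * 16^n) + (5:ℤ)^p * 5^q * 2^r * 4^s * 16^n + (5:ℤ)^p * 2^q * 5^r * 4^s * 16^n + (4:ℤ)^p * 4^q * 3^r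 * 4^s * 16^n + (4:ℤ)^p * 3^q * 4^r * 4^s * 16^n - 2 * ((4:ℤ)^p * 2^q * 4^r * 3^s * 16^n) - 2 * ((4:ℤ)^p * 4^q * 2^r * 3^s * 16^n) - (4:ℤ)^p * 2^q * 2^r * 2^s * 16^n + 2 * ((3:ℤ)^p * 4^r * 2^s * 16^n) + 2 * ((3:ℤ)^p * 4^q * 2^s * 16^n) - (2:ℤ)^p * 4^q * 2^s * 16^n - (2:ℤ)^p * 4^r * 2^s * 16^n + 2 * ((2:ℤ)^p * 2^q * 2^r * 0^s * 16^n) - (2:ℤ)^p * 2^q * 0^s * 16^n - (2:ℤ)^p * 2^r * 0^s * 16^n - (2:ℤ)^q * 0^s * 16^n - (2:ℤ)^r * 0^s * 16^n + (16:ℤ)^n + 2 * ((0:ℤ)^s * 16^n)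

end PercRepro.StarGadget
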